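import Literature.Probability.RandomPlanarGeometry.SLEThrHorizon
import Literature.Probability.RandomPlanarGeometry.LoewnerPartialContactCurve
import Literature.Probability.RandomPlanarGeometry.SLEImageLocalisationTimes
import Literature.Probability.RandomPlanarGeometry.SLERestrictionMartingaleProofs
import Literature.Probability.RandomPlanarGeometry.RohdeSchrammCor35Proofs
import HarnessLib

/-!
# The through-swallow horizon: stopping time, closed remaining hull, margin of the trace, exhaustion

Topic `Probability/RandomPlanarGeometry`; theorems only. Properties of the through-swallow horizon
`thrHorizon κ A δ N` (`SLEThrHorizon`; Lawler–Schramm–Werner (2001) Thm. 2.2, G. F. Lawler (2005)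
§6.3 Thm. 6.13: the conformal image `Φ_t(U_t)` of the SLE₆ driver is followed up to the exit of the
curve from the neighbourhood, through the instants at which whole pieces of `A` are swallowed) for a
nonempty `*`-hull `A`, `δ > 0`, `ρ = thrRadius A δ`:

* `isStoppingTime_thrHorizon` — a stopping time of the raw Brownian filtration
  (`LoewnerPartialContactHull.measurableSet_partialContactTime_le`, `isStoppingTime_capTimeK`);
* `isClosed_remHull_of_coe_lt_thrHorizon`, `finite_image_remHull_of_thrHorizon_eq`,
  `deltaCluster_subset_closedHull_or_disjoint_of_coe_lt_thrHorizon` — for EVERY path, strictly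
  before the horizon the remaining hull `A ∖ K̂_t` is closed, it takes finitely many values on
  `[0, H]`, and every `ρ`-cluster is swallowed whole or missed;
* `thrRadius_le_infDist_sleTrace_of_coe_le_thrHorizon`, `sleTrace_notMem_of_coe_le_thrHorizon` — for
  every path the trace is `ρ`-far from `A` up to and including the horizon (for the null set of paths
  whose chain is not generated by a curve the trace is the constant `0`);
* `ae_isClosed_remHull_of_coe_le_thrHorizon`, `ae_deltaCluster_subset_closedHull_or_disjoint` — almost
  surely (the chain is generated by the trace, Rohde–Schramm), closedness and the dichotomy hold up to
  and including the horizon;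
* `eventually_coe_lt_thrHorizon` — EXHAUSTION: if the stopping set `S'` contains the `δ`-neighbourhood
  of `A` in `ℍ̄` and the trace hits `S'` strictly before `A`, then its first hit of `S'` is strictly
  before the horizon at every large cap level (at a finite partial contact time the curve is `ρ`-close
  to `A`, `LoewnerPartialContactCurve`, having entered `S'` strictly earlier);
* `exists_thrHorizon` — the packaged statement at `κ = 6` (stub `stub_thrHorizon` of the crux
  `stmt-CriticalPhenomena-0698`).

## References

* G. F. Lawler, *Conformally Invariant Processes in the Plane* (2005), §6.3 Thm. 6.13. [Lawler2005]
* G. F. Lawler, O. Schramm, W. Werner, Acta Math. 187 (2001), Thm. 2.2. [LawlerSchrammWerner2001]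
* S. Rohde, O. Schramm, Ann. of Math. 161 (2005), Thm. 5.1. [RohdeSchramm2005]
-/

noncomputable section

open Set Filter Topology Metric MeasureTheory
open scoped NNReal

namespace Literature.Probability.RandomPlanarGeometry

open Loewner Literature.Probability.Process

variable {κ : ℝ≥0} {A : Set ℂ} {δ : ℝ}

/-! ### The horizon is a stopping time -/

section StoppingTime

/-- **The partial contact time of the SLE_κ driver is a stopping time of the raw Brownian
filtration** (`*`-hull `A`, `0 < ρ < infDist 0 A`). [cite: Lawler2005, §6.3 Thm. 6.13] -/
theorem isStoppingTime_partialContactTime (κ : ℝ≥0) (hA : IsStarHull A) {ρ : ℝ} (hρ : 0 < ρ)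
    (hρ0 : ρ < infDist 0 A) :
    IsStoppingTime brownianFiltration fun ω ↦ partialContactTime (drvK κ (brownianCPath ω)) A ρ :=
  fun t ↦ measurableSet_partialContactTime_le (mΩ := brownianFiltration t)
    (W := fun ω : ℝ≥0 → ℝ ↦ drvK κ (brownianCPath ω)) (fun _ ↦ continuous_drvK κ _)
    (fun _ ↦ drvK_zero κ _) (fun _ hs ↦ measurable_drvK_brownianCPath_of_le hs) hρ hA hρ0

/-- **The through-swallow horizon is a stopping time** of the raw Brownian filtration. [folklore] -/
theorem isStoppingTime_thrHorizon (hA : IsStarHull A) (hne : A.Nonempty) (hδ : 0 < δ) (N : ℕ) :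
    IsStoppingTime brownianFiltration (thrHorizon κ A δ N) :=
  (isStoppingTime_partialContactTime κ hA (thrRadius_pos hA hne hδ) (thrRadius_lt_infDist hA hne δ)).min
    ((isStoppingTime_capTimeK κ N).min (isStoppingTime_const _ _))

end StoppingTime

/-! ### Pathwise: the remaining hull below the horizon -/

section Pathwise

/-- **Strictly before the horizon the remaining hull `A ∖ K̂_t` is closed**, for every path.
[cite: Lawler2005, §6.3 Thm. 6.13] -/
theorem isClosed_remHull_of_coe_lt_thrHorizon (hA : IsStarHull A) (hne : A.Nonempty) (hδ : 0 < δ)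
    {N : ℕ} {ω : ℝ≥0 → ℝ} {t : ℝ≥0}
    (ht : (t : WithTop ℝ≥0) < thrHorizon κ A δ N ω) :
    IsClosed (remHull (drvK κ (brownianCPath ω)) A t) :=
  isClosed_remHull_of_coe_lt_partialContactTime hA (thrRadius_pos hA hne hδ)
    (coe_lt_partialContactTime_of_coe_lt_thrHorizon ht)

/-- **Up to the horizon the remaining hull takes finitely many values**, for every path. [folklore] -/
theorem finite_image_remHull_of_thrHorizon_eq (hA : IsStarHull A) (hne : A.Nonempty) (hδ : 0 < δ)
    {N : ℕ} {ω : ℝ≥0 → ℝ} {T₀ : ℝ≥0}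
    (hT : thrHorizon κ A δ N ω = T₀) :
    (remHull (drvK κ (brownianCPath ω)) A '' Icc 0 T₀).Finite :=
  finite_image_remHull_Icc_of_coe_le_partialContactTime hA (thrRadius_pos hA hne hδ)
    (coe_le_partialContactTime_of_coe_le_thrHorizon hT.symm.le)

/-- **Strictly before the horizon every `ρ`-cluster of `A` is swallowed whole or missed by the closed
hull**, for every path. [cite: Lawler2005, §6.3 Thm. 6.13] -/
theorem deltaCluster_subset_closedHull_or_disjoint_of_coe_lt_thrHorizon (hA : IsStarHull A) (hne : A.Nonempty) (hδ : 0 < δ)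
    {N : ℕ} {ω : ℝ≥0 → ℝ}
    {t : ℝ≥0} (ht : (t : WithTop ℝ≥0) < thrHorizon κ A δ N ω) {a : ℂ} (ha : a ∈ A) :
    deltaCluster A (thrRadius A δ) a ⊆ closedHull (drvK κ (brownianCPath ω)) t ∨
      Disjoint (deltaCluster A (thrRadius A δ) a) (closedHull (drvK κ (brownianCPath ω)) t) := by
  have him : ∀ z ∈ A, 0 ≤ z.im := fun z hz ↦ hA.isBoundedHull.im_nonneg hz
  rcases disjoint_or_subset_of_coe_lt_partialContactTime hA (thrRadius_pos hA hne hδ)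
      (coe_lt_partialContactTime_of_coe_lt_thrHorizon ht) (deltaCluster_mem_clusterFamily ha) with h | h
  · exact Or.inr (h.symm.mono_left (subset_halfNhd (fun z hz ↦ him z (deltaCluster_subset ha hz))
      (thrRadius_pos hA hne hδ).le))
  · exact Or.inl h

/-! ### Pathwise: the trace keeps the margin `ρ` up to the horizon -/

/-- **Up to and including the horizon the trace is `ρ`-far from `A`**, for every path: for a chain
generated by a curve this is `le_infDist_apply_of_coe_le_partialContactTime`; otherwise the trace is
the constant `0`, at distance `≥ infDist 0 A > ρ`. [cite: Lawler2005, §6.3 Thm. 6.13] -/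
theorem thrRadius_le_infDist_sleTrace_of_coe_le_thrHorizon (hA : IsStarHull A) (hne : A.Nonempty) (hδ : 0 < δ)
    {N : ℕ} {ω : ℝ≥0 → ℝ} {t : ℝ≥0}
    (ht : (t : WithTop ℝ≥0) ≤ thrHorizon κ A δ N ω) : thrRadius A δ ≤ infDist (sleTrace κ ω t) A := by
  by_cases hgen : ∃ γ, IsGeneratedByCurve (sleDriving κ ω) γ
  · have hγ : IsGeneratedByCurve (sleDriving κ ω) (sleTrace κ ω) := isGeneratedByCurve_trace hgen
    have ht' := coe_le_partialContactTime_of_coe_le_thrHorizon ht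
    rw [drvK_brownianCPath] at ht'
    exact le_infDist_apply_of_coe_le_partialContactTime hγ (continuous_sleDriving κ ω) (sleDriving_zero κ ω)
      hA hne (thrRadius_pos hA hne hδ) (thrRadius_lt_infDist hA hne δ) ht'
  · rw [sleTrace_of_not_isGeneratedByCurve hgen t]
    exact (thrRadius_le_half_infDist A δ).trans (half_le_self infDist_nonneg)

/-- **Up to and including the horizon the trace is off `A`**, for every path. [folklore] -/
theorem sleTrace_notMem_of_coe_le_thrHorizon (hA : IsStarHull A) (hne : A.Nonempty) (hδ : 0 < δ)
    {N : ℕ} {ω : ℝ≥0 → ℝ} {t : ℝ≥0}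
    (ht : (t : WithTop ℝ≥0) ≤ thrHorizon κ A δ N ω) : sleTrace κ ω t ∉ A := fun h ↦ by
  have := thrRadius_le_infDist_sleTrace_of_coe_le_thrHorizon hA hne hδ ht
  rw [infDist_zero_of_mem h] at this
  exact absurd this (not_le.2 (thrRadius_pos hA hne hδ))

/-! ### Up to and including the horizon, when the chain is generated by a curve (almost surely) -/

/-- When the chain of `ω` is generated by a curve, the remaining hull is closed up to and INCLUDING
the horizon. [cite: Lawler2005, §6.3 Thm. 6.13] -/
theorem isClosed_remHull_of_coe_le_thrHorizon_of_exists (hA : IsStarHull A) (hne : A.Nonempty) (hδ : 0 < δ)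
    {N : ℕ} {ω : ℝ≥0 → ℝ} {t : ℝ≥0}
    (hgen : ∃ γ, IsGeneratedByCurve (sleDriving κ ω) γ) (ht : (t : WithTop ℝ≥0) ≤ thrHorizon κ A δ N ω) :
    IsClosed (remHull (drvK κ (brownianCPath ω)) A t) := by
  have hγ : IsGeneratedByCurve (sleDriving κ ω) (sleTrace κ ω) := isGeneratedByCurve_trace hgen
  have ht' := coe_le_partialContactTime_of_coe_le_thrHorizon ht
  rw [drvK_brownianCPath] at ht' ⊢
  exact isClosed_remHull_of_coe_le_partialContactTime hγ (continuous_sleDriving κ ω) (sleDriving_zero κ ω)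
    hA hne (thrRadius_pos hA hne hδ) (thrRadius_lt_infDist hA hne δ) ht'

/-- When the chain of `ω` is generated by a curve, the cluster dichotomy holds up to and INCLUDING the
horizon. [cite: Lawler2005, §6.3 Thm. 6.13] -/
theorem deltaCluster_subset_closedHull_or_disjoint_of_coe_le_thrHorizon_of_exists (hA : IsStarHull A) (hne : A.Nonempty) (hδ : 0 < δ)
    {N : ℕ}
    {ω : ℝ≥0 → ℝ} {t : ℝ≥0} (hgen : ∃ γ, IsGeneratedByCurve (sleDriving κ ω) γ)
    (ht : (t : WithTop ℝ≥0) ≤ thrHorizon κ A δ N ω) {a : ℂ} (ha : a ∈ A) :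
    deltaCluster A (thrRadius A δ) a ⊆ closedHull (drvK κ (brownianCPath ω)) t ∨
      Disjoint (deltaCluster A (thrRadius A δ) a) (closedHull (drvK κ (brownianCPath ω)) t) := by
  have hγ : IsGeneratedByCurve (sleDriving κ ω) (sleTrace κ ω) := isGeneratedByCurve_trace hgen
  have ht' := coe_le_partialContactTime_of_coe_le_thrHorizon ht
  rw [drvK_brownianCPath] at ht' ⊢
  exact deltaCluster_subset_closedHull_or_disjoint_of_coe_le_partialContactTime hγ
    (continuous_sleDriving κ ω) (sleDriving_zero κ ω) hA hne (thrRadius_pos hA hne hδ)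
    (thrRadius_lt_infDist hA hne δ) ht' ha

/-- **Almost surely the remaining hull is closed up to and including the horizon** (`κ ≠ 8`: the
chain is a.s. generated by the trace, Rohde–Schramm). [cite: RohdeSchramm2005, Thm 5.1] -/
theorem ae_isClosed_remHull_of_coe_le_thrHorizon (hA : IsStarHull A) (hne : A.Nonempty) (hδ : 0 < δ)
    (hκ : κ ≠ 8) :
    ∀ᵐ ω ∂preWienerMeasure, ∀ (N : ℕ) (t : ℝ≥0), (t : WithTop ℝ≥0) ≤ thrHorizon κ A δ N ω →
      IsClosed (remHull (drvK κ (brownianCPath ω)) A t) := by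
  have h : ∀ᵐ ω ∂preWienerMeasure, ∃ γ, IsGeneratedByCurve (sleDriving κ ω) γ :=
    hasSLETrace_of_ne_eight_apply hκ
  filter_upwards [h] with ω hω N t ht
  exact isClosed_remHull_of_coe_le_thrHorizon_of_exists hA hne hδ hω ht

/-- **Almost surely the cluster dichotomy holds up to and including the horizon** (`κ ≠ 8`).
[cite: RohdeSchramm2005, Thm 5.1] -/
theorem ae_deltaCluster_subset_closedHull_or_disjoint (hA : IsStarHull A) (hne : A.Nonempty) (hδ : 0 < δ)
    (hκ : κ ≠ 8) :
    ∀ᵐ ω ∂preWienerMeasure, ∀ (N : ℕ) (t : ℝ≥0), (t : WithTop ℝ≥0) ≤ thrHorizon κ A δ N ω →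
      ∀ a ∈ A, deltaCluster A (thrRadius A δ) a ⊆ closedHull (drvK κ (brownianCPath ω)) t ∨
        Disjoint (deltaCluster A (thrRadius A δ) a) (closedHull (drvK κ (brownianCPath ω)) t) := by
  have h : ∀ᵐ ω ∂preWienerMeasure, ∃ γ, IsGeneratedByCurve (sleDriving κ ω) γ :=
    hasSLETrace_of_ne_eight_apply hκ
  filter_upwards [h] with ω hω N t ht a ha
  exact deltaCluster_subset_closedHull_or_disjoint_of_coe_le_thrHorizon_of_exists hA hne hδ hω ht ha

/-! ### Exhaustion of the first hit of the stopping set -/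

/-- **Exhaustion.** If `S'` contains the `δ`-neighbourhood of `A` in `ℍ̄` and the trace of `ω` hits
`S'` strictly before `A`, then its first hit `t` of `S'` satisfies `t < thrHorizon κ A δ N ω` for all
large `N`: `t` is finite, the driver is bounded on `[0, t]` (so only finitely many cap levels bind,
and `t < N + 1` eventually), and `t < partialContactTime` — at a finite partial contact time `u` the
curve has come `ρ`-close to `A` at some `s ≤ u` (`exists_infDist_apply_le_of_partialContactTime_eq`),
`s > 0`, so it was already in `S' ⊇ {infDist ≤ δ}` slightly before `s`; for the paths whose chain is
not generated by a curve the trace is `0 ∈ S'`, `t = 0 < partialContactTime`.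
[cite: Lawler2005, §6.3 Thm. 6.13] -/
theorem eventually_coe_lt_thrHorizon (hA : IsStarHull A) (hne : A.Nonempty) (hδ : 0 < δ)
    (ω : ℝ≥0 → ℝ) {S' : Set ℂ}
    (hS' : ∀ z : ℂ, 0 ≤ z.im → infDist z A ≤ δ → z ∈ S')
    (hlt : firstHit (sleTrace κ ω) S' < firstHit (sleTrace κ ω) A) :
    ∃ t : ℝ≥0, firstHit (sleTrace κ ω) S' = t ∧
      ∀ᶠ N in atTop, (t : WithTop ℝ≥0) < thrHorizon κ A δ N ω := by
  have hρ := thrRadius_pos hA hne hδ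
  have hρ0 := thrRadius_lt_infDist hA hne δ
  have hWeq : drvK κ (brownianCPath ω) = sleDriving κ ω := drvK_brownianCPath κ ω
  have hWc : Continuous (drvK κ (brownianCPath ω)) := continuous_drvK κ _
  have hW0 : drvK κ (brownianCPath ω) 0 = 0 := drvK_zero κ _
  obtain ⟨t, ht⟩ := WithTop.ne_top_iff_exists.1 (ne_top_of_lt hlt)
  refine ⟨t, ht.symm, ?_⟩
  -- (i) `t < partialContactTime`
  have hi : (t : WithTop ℝ≥0) < partialContactTime (drvK κ (brownianCPath ω)) A (thrRadius A δ) := by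
    by_cases hgen : ∃ c, IsGeneratedByCurve (sleDriving κ ω) c
    · have hγ : IsGeneratedByCurve (drvK κ (brownianCPath ω)) (sleTrace κ ω) := by
        rw [hWeq]; exact isGeneratedByCurve_trace hgen
      rcases eq_or_ne (partialContactTime (drvK κ (brownianCPath ω)) A (thrRadius A δ)) ⊤ with htop | hnt
      · rw [htop]; exact WithTop.coe_lt_top t
      · obtain ⟨u, hu⟩ := WithTop.ne_top_iff_exists.1 hnt
        obtain ⟨s, hsu, hs⟩ :=
          exists_infDist_apply_le_of_partialContactTime_eq hγ hWc hW0 hA hρ hρ0 hu.symm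
        -- `s > 0`: the trace starts at `0`, farther than `ρ` from `A`
        have hs0 : 0 < s := by
          rcases eq_zero_or_pos (a := s) with h | h
          · subst h
            rw [hγ.apply_zero, hW0, Complex.ofReal_zero] at hs
            exact absurd (hs.trans_lt hρ0) (lt_irrefl _)
          · exact h
        -- a time `r < s` at which the trace is already in `S'`
        have hcont : ContinuousAt (fun r ↦ infDist (sleTrace κ ω r) A) s :=
          ((continuous_infDist_pt A).comp hγ.continuous).continuousAt
        have hev : ∀ᶠ r in 𝓝 s, infDist (sleTrace κ ω r) A < δ :=
          hcont.eventually (gt_mem_nhds (hs.trans_lt (thrRadius_lt A hδ)))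
        haveI : (𝓝[<] s).NeBot := nhdsLT_neBot_of_exists_lt ⟨0, hs0⟩
        have hev' : ∀ᶠ r in 𝓝[<] s, infDist (sleTrace κ ω r) A < δ := hev.filter_mono nhdsWithin_le_nhds
        obtain ⟨r, hr, hrs⟩ := (hev'.and self_mem_nhdsWithin).exists
        have hrS : sleTrace κ ω r ∈ S' := hS' _ (hγ.im_nonneg r) hr.le
        have h1 : (t : WithTop ℝ≥0) ≤ r := by rw [ht]; exact firstHit_le hrS
        rw [← hu]
        exact lt_of_le_of_lt h1 (WithTop.coe_lt_coe.2 (lt_of_lt_of_le hrs hsu))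
    · -- no generating curve: the trace is the constant `0 ∈ S'`, so `t = 0`
      have hγ0 : ∀ r, sleTrace κ ω r = 0 := sleTrace_of_not_isGeneratedByCurve hgen
      have ht0 : t = 0 := by
        have hne' : firstHit (sleTrace κ ω) S' ≠ ⊤ := by rw [← ht]; exact WithTop.coe_ne_top
        obtain ⟨r, hr⟩ : ∃ r, sleTrace κ ω r ∈ S' := by
          by_contra h
          push Not at h
          exact hne' (firstHit_eq_top h)
        rw [hγ0 r] at hr
        have h0 : firstHit (sleTrace κ ω) S' ≤ ((0 : ℝ≥0) : WithTop ℝ≥0) :=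
          firstHit_le (by rw [hγ0 0]; exact hr)
        rw [← ht, WithTop.coe_le_coe] at h0
        exact le_antisymm h0 bot_le
      rw [ht0]
      exact partialContactTime_pos hA hρ hWc hW0 hρ0
  -- (ii) the driver is bounded on `[0, t]`
  obtain ⟨B, hB⟩ := isCompact_Icc.exists_bound_of_continuousOn (s := Icc (0 : ℝ≥0) t) hWc.continuousOn
  have h4 : ∀ᶠ m : ℕ in atTop, B < (m : ℝ) + 1 :=
    (tendsto_natCast_atTop_atTop.atTop_add tendsto_const_nhds).eventually (eventually_gt_atTop B)
  have h5 : ∀ᶠ m : ℕ in atTop, (t : ℝ) < (m : ℝ) + 1 :=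
    (tendsto_natCast_atTop_atTop.atTop_add tendsto_const_nhds).eventually (eventually_gt_atTop _)
  filter_upwards [h4, h5] with m hm4 hm5
  have hiv : (t : WithTop ℝ≥0) < capTimeK κ m ω := by
    by_contra hle
    rw [not_lt] at hle
    obtain ⟨j, hj, hjs⟩ := (hittingAfter_zero_le_coe_iff isClosed_Ici hWc.abs).1 hle
    have hjs' : (m : ℝ) + 1 ≤ |drvK κ (brownianCPath ω) j| := hjs
    have := hB j ⟨bot_le, hj⟩
    rw [Real.norm_eq_abs] at this
    linarith
  have hiii : (t : WithTop ℝ≥0) < (((m : ℝ≥0) + 1 : ℝ≥0) : WithTop ℝ≥0) := by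
    have : t < (m : ℝ≥0) + 1 := by exact_mod_cast hm5
    exact_mod_cast this
  rw [thrHorizon_def]
  exact lt_min hi (lt_min hiv hiii)

end Pathwise

/-! ### The packaged statement at `κ = 6` -/

/-- **The through-swallow horizon of the locality of SLE₆ with respect to a nonempty `*`-hull**
(stub `stub_thrHorizon`): with `H N = thrHorizon 6 A δ N`, (a) each `H N` is a stopping time of the
raw Brownian filtration; (b) finite; (c) `≤ capTimeK 6 N`; (d) strictly before `H N` the remaining hull
`A ∖ K̂_t` is closed, for every path; (d2) it takes finitely many values on `[0, H N]`; (d3) the trace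
is off `A` up to and including `H N`; (f) indeed at distance `≥ min (δ/2) (infDist 0 A / 2)` from `A`;
(d') almost surely the remaining hull is closed up to and including `H N`; (e) almost surely, for every
stopping set `S'` containing the `δ`-neighbourhood of `A` in `ℍ̄`, if the trace hits `S'` strictly
before `A` then its first hit of `S'` is strictly before `H N` for all large `N`.
[cite: Lawler2005, §6.3 Thm. 6.13] -/
theorem exists_thrHorizon {A : Set ℂ} (hA : IsStarHull A) (hne : A.Nonempty) {δ : ℝ} (hδ : 0 < δ) :
    ∃ H : ℕ → (ℝ≥0 → ℝ) → WithTop ℝ≥0,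
      (∀ N, IsStoppingTime brownianFiltration (H N)) ∧
      (∀ N ω, H N ω ≠ ⊤) ∧
      (∀ N ω, H N ω ≤ capTimeK 6 N ω) ∧
      (∀ N ω (t : ℝ≥0), (t : WithTop ℝ≥0) < H N ω →
        IsClosed (remHull (drvK 6 (brownianCPath ω)) A t)) ∧
      (∀ N ω (T₀ : ℝ≥0), H N ω = T₀ →
        (remHull (drvK 6 (brownianCPath ω)) A '' Icc 0 T₀).Finite) ∧
      (∀ N ω (t : ℝ≥0), (t : WithTop ℝ≥0) ≤ H N ω → sleTrace 6 ω t ∉ A) ∧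
      (∀ N ω (t : ℝ≥0), (t : WithTop ℝ≥0) ≤ H N ω →
        min (δ / 2) (infDist 0 A / 2) ≤ infDist (sleTrace 6 ω t) A) ∧
      (∀ᵐ ω ∂preWienerMeasure, ∀ N (t : ℝ≥0), (t : WithTop ℝ≥0) ≤ H N ω →
        IsClosed (remHull (drvK 6 (brownianCPath ω)) A t)) ∧
      (∀ᵐ ω ∂preWienerMeasure, ∀ S' : Set ℂ,
        (∀ z : ℂ, 0 ≤ z.im → infDist z A ≤ δ → z ∈ S') →
        firstHit (sleTrace 6 ω) S' < firstHit (sleTrace 6 ω) A →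
        ∃ t : ℝ≥0, firstHit (sleTrace 6 ω) S' = t ∧ ∀ᶠ N in atTop, (t : WithTop ℝ≥0) < H N ω) := by
  have h68 : (6 : ℝ≥0) ≠ 8 := by norm_num
  refine ⟨thrHorizon 6 A δ, isStoppingTime_thrHorizon hA hne hδ, thrHorizon_ne_top,
    thrHorizon_le_capTimeK, fun N ω t ht ↦ isClosed_remHull_of_coe_lt_thrHorizon hA hne hδ ht,
    fun N ω T₀ hT ↦ finite_image_remHull_of_thrHorizon_eq hA hne hδ hT,
    fun N ω t ht ↦ sleTrace_notMem_of_coe_le_thrHorizon hA hne hδ ht,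
    fun N ω t ht ↦ thrRadius_le_infDist_sleTrace_of_coe_le_thrHorizon hA hne hδ ht,
    ae_isClosed_remHull_of_coe_le_thrHorizon hA hne hδ h68,
    Eventually.of_forall fun ω S' hS' hlt ↦ eventually_coe_lt_thrHorizon hA hne hδ ω hS' hlt⟩

end Literature.Probability.RandomPlanarGeometry

end
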